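import Literature.NumberTheory.Transcendental.LWMeasureConstruction
import Literature.NumberTheory.Transcendental.BWAnalytic
import HarnessLib

/-!
# The auxiliary polynomials of the Lindemann–Weierstrass measure (Ably 1994, §II) — the analytic identities

`Literature/NumberTheory/Transcendental/LWMeasureAnalytic.lean` — proofs (and two abbreviations
with bodies), no named facts. Third file of the proof of Ably's "Proposition principale" behind
`Ably1994_lindemannWeierstrass_measure`: the link between the polynomials `Q_{s,h,j} ∈ ℤ[w, X]`
of `LWMeasureConstruction.lean` and the entire function
`f(z) = ∑_{β<L, γ<D} a_{β,γ} z^β e^{γz}` (`F a`, Baker's exponential polynomial `expPolynomial`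
of `TijdemanZeroEstimate.lean` with the frequencies `0, 1, …, D − 1`) and its translates.

* `iteratedDeriv_F` — `f^{(s)}(u) = ∑ a_{β,γ} Δ_s(β,γ;u) e^{γu}`,
  `Δ_s(β,γ;u) = ∑_{i≤s} C(s,i) β(β−1)⋯(β−i+1) u^{β−i} γ^{s−i}`
  (`BrownawellWaldschmidt.iteratedDeriv_expPolynomial`).
* `iteratedDeriv_translate` — `(d/dt)^s [∑ a_{β,γ} (u+t)^β (ξe^t)^γ]_{t=0} = ∑ a_{β,γ} Δ_s(β,γ;u) ξ^γ`
  for ANY `ξ` (the perturbed functions `F_h(z) = P(h·y + z, e^{h·ỹ+z})` of Lemme 3, p. 40).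
* `Setup.sum_mul_aeval_Mt`, `Setup.aeval_Qj_eq_iteratedDeriv` — at every point `(α, z)`:
  `Q_{s,h,j}(α, z) = c^L (d/dt)^s[∑ P_{β,γ,j}(α,z) (h·y + t)^β (z^h e^t)^γ]_{t=0}`, the form consumed
  by the zero estimate; `Setup.sum_mul_aeval_Mt_exp` — at the true point `(α, e^{y})`:
  `∑ a_{β,γ} M̃_{β,γ,h,s}(α, e^y) = c^L f^{(s)}(h·y)` (p. 37,
  "`(d^s/dz^s) f(h·y) = ∑ D^jP_{β,γ}(θ̃) M_{β,γ,h,s}(θ)`"), the form consumed by the extrapolation.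

## References

* [Ably1994] M. Ably, *Une version quantitative du théorème de Lindemann–Weierstrass*, Acta Arith.
  67 (1994) 29–45, §II 2e pas p. 37 and Lemme 3 p. 40.
* [BakerTNT1975] A. Baker, *Transcendental Number Theory* (1975), Ch. 12 §5 (the derivatives of
  exponential polynomials).
-/

noncomputable section

open scoped Polynomial
open MvPolynomial Finset Finsupp Complex

namespace Literature.NumberTheory.Transcendental

namespace LWMeasure

/-! ### Ably's auxiliary function as an exponential polynomial -/

/-- The frequencies `γ = 0, 1, …, D - 1` of `f(z) = ∑ p_{β,γ} z^β e^{γz}`.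
[cite: Ably1994, §II 2e pas p. 37] -/
def freq (D : ℕ) : Fin D → ℂ := fun γ => ((γ : ℕ) : ℂ)

/-- `freq D γ = γ`. [folklore] -/
@[simp] theorem freq_apply {D : ℕ} (γ : Fin D) : freq D γ = ((γ : ℕ) : ℂ) := rfl

/-- `|γ| ≤ D`. [folklore] -/
theorem norm_freq_le {D : ℕ} (γ : Fin D) : ‖freq D γ‖ ≤ D := by
  rw [freq_apply, Complex.norm_natCast]
  exact_mod_cast γ.isLt.le

/-- **The entire function `f(z) = ∑_{β<L, γ<D} a_{β,γ} z^β e^{γz}`** of Ably's 2e pas (p. 37) with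
coefficients `a_{β,γ} = D^jP_{β,γ}(θ̃)`: Baker's exponential polynomial with the frequencies
`0, 1, …, D-1`. [cite: Ably1994, §II 2e pas p. 37] -/
abbrev F {L D : ℕ} (a : Fin L → Fin D → ℂ) : ℂ → ℂ := expPolynomial a (freq D)

/-- The inner sums `Δ_s(β, γ; u) = ∑_{i≤s} C(s,i) β(β-1)⋯(β-i+1) u^{β-i} γ^{s-i}`. [folklore] -/
def Δ (s β γ : ℕ) (u : ℂ) : ℂ :=
  ∑ i ∈ range (s + 1), ((s.choose i * β.descFactorial i : ℕ) : ℂ) * u ^ (β - i) * (γ : ℂ) ^ (s - i)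

/-- **`f^{(s)}(u) = ∑ a_{β,γ} Δ_s(β,γ;u) e^{γu}`.** [cite: Ably1994, §II 2e pas p. 37] -/
theorem iteratedDeriv_F {L D : ℕ} (a : Fin L → Fin D → ℂ) (s : ℕ) (u : ℂ) :
    iteratedDeriv s (F a) u =
      ∑ β : Fin L, ∑ γ : Fin D, a β γ * Δ s β γ u * cexp ((γ : ℕ) * u) := by
  rw [BrownawellWaldschmidt.iteratedDeriv_expPolynomial]
  rfl

/-- **The translated and perturbed functions** `t ↦ ∑ a_{β,γ} (u + t)^β (ξ e^t)^γ` (Ably's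
`F_h(z) = P(h·y + z, e^{h·ỹ + z})`, p. 40, `u = h·y`, `ξ = e^{h·ỹ}`): their derivatives at `0` are
`∑ a_{β,γ} Δ_s(β,γ;u) ξ^γ`. [cite: Ably1994, §II Lemme 3 p. 40] -/
theorem iteratedDeriv_translate {L D : ℕ} (a : Fin L → Fin D → ℂ) (u ξ : ℂ) (s : ℕ) :
    iteratedDeriv s (fun t : ℂ => ∑ β : Fin L, ∑ γ : Fin D,
        a β γ * (u + t) ^ (β : ℕ) * (ξ * cexp t) ^ (γ : ℕ)) 0 =
      ∑ β : Fin L, ∑ γ : Fin D, a β γ * Δ s β γ u * ξ ^ (γ : ℕ) := by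
  -- the function is `t ↦ F a' (u + t)` with `a' = a ξ^γ e^{-γu}`
  set a' : Fin L → Fin D → ℂ := fun β γ => a β γ * ξ ^ (γ : ℕ) * cexp (-((γ : ℕ) * u)) with ha'
  have hfun : (fun t : ℂ => ∑ β : Fin L, ∑ γ : Fin D,
      a β γ * (u + t) ^ (β : ℕ) * (ξ * cexp t) ^ (γ : ℕ)) = fun t => F a' (u + t) := by
    funext t
    simp only [F, expPolynomial_apply, ha', freq_apply]
    refine sum_congr rfl fun β _ => sum_congr rfl fun γ _ => ?_
    rw [mul_pow, ← Complex.exp_nat_mul]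
    have : cexp (-((γ : ℕ) * u)) * cexp ((γ : ℕ) * (u + t)) = cexp ((γ : ℕ) * t) := by
      rw [← Complex.exp_add]; ring_nf
    calc a β γ * (u + t) ^ (β : ℕ) * (ξ ^ (γ : ℕ) * cexp ((γ : ℕ) * t))
        = a β γ * (u + t) ^ (β : ℕ) * (ξ ^ (γ : ℕ) * (cexp (-((γ : ℕ) * u)) *
            cexp ((γ : ℕ) * (u + t)))) := by rw [this]
      _ = _ := by ring
  rw [hfun, iteratedDeriv_comp_const_add s (F a') u]
  simp only [add_zero]
  rw [iteratedDeriv_F]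
  refine sum_congr rfl fun β _ => sum_congr rfl fun γ _ => ?_
  simp only [ha']
  have : cexp (-((γ : ℕ) * u)) * cexp ((γ : ℕ) * u) = 1 := by
    rw [← Complex.exp_add]; simp
  calc a β γ * ξ ^ (γ : ℕ) * cexp (-((γ : ℕ) * u)) * Δ s β γ u * cexp ((γ : ℕ) * u)
      = a β γ * Δ s β γ u * ξ ^ (γ : ℕ) * (cexp (-((γ : ℕ) * u)) * cexp ((γ : ℕ) * u)) := by ring
    _ = _ := by rw [this, mul_one]

/-- `f` is entire. [folklore] -/
theorem differentiable_F {L D : ℕ} (a : Fin L → Fin D → ℂ) : Differentiable ℂ (F a) :=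
  BrownawellWaldschmidt.differentiable_expPolynomial a _

namespace Setup

variable (S : Setup) {L D b : ℕ}

/-- The true point `θⱼ = e^{yⱼ}`. [cite: Ably1994, §II p. 33] -/
def θ : Fin S.n → ℂ := fun j => cexp (S.y j)

/-- `θⱼ = e^{yⱼ}`. [folklore] -/
@[simp] theorem θ_apply (j : Fin S.n) : S.θ j = cexp (S.y j) := rfl

/-- `e^{h·y} = ∏ θⱼ^{hⱼ}`. [folklore] -/
theorem cexp_hy (h : Fin S.n → ℕ) : cexp (S.hy h) = ∏ j, S.θ j ^ h j := by
  unfold hy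
  rw [Complex.exp_sum]
  exact prod_congr rfl fun j _ => by rw [θ_apply, ← Complex.exp_nat_mul]

/-- **`∑ a_{β,γ} M̃_{β,γ,h,s}(α, z) = c^L (d/dt)^s [∑ a_{β,γ} (h·y + t)^β (z^h e^t)^γ]_{t=0}`**
for any coefficients `a` and any point `z` (`z^h = ∏ zⱼ^{hⱼ}`).
[cite: Ably1994, §II p. 34 ("`M_{β,γ,h,s}(θ) = Δ_s M_{β,γ}(h·y, e^{h·y})`"), Lemme 3 p. 40] -/
theorem sum_mul_aeval_Mt (z : Fin S.n → ℂ) (a : Fin L → Fin D → ℂ) (h : Fin S.n → ℕ) (s : ℕ) :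
    ∑ βγ : Fin L × Fin D, a βγ.1 βγ.2 *
        aeval (Fin.cons S.α z : Fin (S.n + 1) → ℂ) (S.Mt L βγ.1 βγ.2 h s) =
      (S.c : ℂ) ^ L * iteratedDeriv s (fun t : ℂ => ∑ β : Fin L, ∑ γ : Fin D,
        a β γ * (S.hy h + t) ^ (β : ℕ) * ((∏ j, z j ^ h j) * cexp t) ^ (γ : ℕ)) 0 := by
  rw [iteratedDeriv_translate, Fintype.sum_prod_type, Finset.mul_sum]
  refine sum_congr rfl fun β _ => ?_
  rw [Finset.mul_sum]
  refine sum_congr rfl fun γ _ => ?_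
  rw [S.aeval_Mt z β.isLt (γ : ℕ) h s, Δ]
  simp only [Finset.mul_sum, Finset.sum_mul]
  refine sum_congr rfl fun i _ => ?_
  ring

/-- `Q_{s,h,j}(x) = ∑_{β,γ} P_{β,γ,j}(x) M̃_{β,γ,h,s}(x)`. [folklore] -/
theorem aeval_Qj (p : Unk S.n L D b → ℤ) (h : Fin S.n → ℕ) (s : ℕ) (j : Fin (S.n + 1) →₀ ℕ)
    (x : Fin (S.n + 1) → ℂ) :
    aeval x (S.Qj p h s j) = ∑ βγ : Fin L × Fin D, aeval x (S.Pj p βγ j) * aeval x (S.Mt L βγ.1 βγ.2 h s) := by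
  unfold Qj
  rw [map_sum]
  exact sum_congr rfl fun βγ _ => map_mul _ _ _

/-- **`Q_{s,h,j}(α, z) = c^L (d/dt)^s[∑ P_{β,γ,j}(α,z) (h·y + t)^β (z^h e^t)^γ]_{t=0}`** at every
point `z` — the form consumed by the zero estimate (Lemme 3). [cite: Ably1994, §II Lemme 3 p. 40] -/
theorem aeval_Qj_eq_iteratedDeriv (p : Unk S.n L D b → ℤ) (z : Fin S.n → ℂ) (h : Fin S.n → ℕ)
    (s : ℕ) (j : Fin (S.n + 1) →₀ ℕ) :
    aeval (Fin.cons S.α z : Fin (S.n + 1) → ℂ) (S.Qj p h s j) =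
      (S.c : ℂ) ^ L * iteratedDeriv s (fun t : ℂ => ∑ β : Fin L, ∑ γ : Fin D,
        aeval (Fin.cons S.α z : Fin (S.n + 1) → ℂ) (S.Pj p (β, γ) j) *
          (S.hy h + t) ^ (β : ℕ) * ((∏ j, z j ^ h j) * cexp t) ^ (γ : ℕ)) 0 := by
  rw [aeval_Qj, ← S.sum_mul_aeval_Mt z (fun β γ => aeval (Fin.cons S.α z : Fin (S.n + 1) → ℂ)
    (S.Pj p (β, γ) j)) h s]

/-- **At the true point `θ = (α, e^{y₁}, …, e^{yₙ})`**:
`∑ a_{β,γ} M̃_{β,γ,h,s}(θ) = c^L f^{(s)}(h·y)` with `f = ∑ a_{β,γ} z^β e^{γz}`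
(Ably, p. 37: "`(d^s/dz^s) f(h·y) = ∑ D^jP_{β,γ}(θ̃) M_{β,γ,h,s}(θ)`").
[cite: Ably1994, §II 2e pas p. 37] -/
theorem sum_mul_aeval_Mt_exp (a : Fin L → Fin D → ℂ) (h : Fin S.n → ℕ) (s : ℕ) :
    ∑ βγ : Fin L × Fin D, a βγ.1 βγ.2 *
        aeval (Fin.cons S.α S.θ : Fin (S.n + 1) → ℂ) (S.Mt L βγ.1 βγ.2 h s) =
      (S.c : ℂ) ^ L * iteratedDeriv s (F a) (S.hy h) := by
  rw [S.sum_mul_aeval_Mt, iteratedDeriv_translate, iteratedDeriv_F]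
  congr 1
  refine sum_congr rfl fun β _ => sum_congr rfl fun γ _ => ?_
  rw [← S.cexp_hy h, ← Complex.exp_nat_mul]

end Setup

end LWMeasure

end Literature.NumberTheory.Transcendental

end
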